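import Summits.ValiantsHypothesis.ValiantsHypothesis.Theorems.FeketeSOSFeketeSOSHardPaleyRIPDefs
import Mathlib.Analysis.InnerProductSpace.Basic

/-!
# Route FeketeSOS — crux `FeketeSOSHard` (stmt-ValiantsHypothesis-3996), line `paley-rip`,
# stub `stub_paleyFlatRIP`: polarisation of the Paley–Hankel form (quadratic ⇒ bilinear ⇒ flat)

`stub_paleyFlatRIP` (the line's ENGINE) says: `∃ κ, δ₁ > 0` such that for all large primes `p`, every
`S ⊆ [0,p)` with `#S ≤ p^{1/2+δ₁}` and every `w : ℕ → ℂ`,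
`|Q_p(S,w)| ≤ p^{1/2−κ} Σ_{a∈S} |w_a|²`, `Q_p(S,w) = Σ_{a,b∈S} χ_p(a+b) w_a w_b` (`paleyForm`): every
principal `p^{1/2+δ₁}`-block of the Paley–Hankel matrix `(χ_p(a+b))_{a,b}` has operator norm `≤ p^{1/2−κ}`
— the restricted-isometry property of the Paley matrix BEYOND the square-root bottleneck
(Bandeira–Mixon–Moreira, IMRN 2017, arXiv:1410.6457, Def. 2.1 / Thm 2.3, derived there from Chung's 1994
discrepancy conjecture, J. Number Theory 49, Conj. 2.2).  It is a NAMED OPEN PROBLEM; this file does not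
prove it.  It records, sorry-free, the elementary bookkeeping the line and its consequences use:

* (trivial range, recorded in `…PaleyRIPTameStatus.lean` as `norm_paleyForm_le_card_mul`:
  `|Q_p(S,w)| ≤ #S · Σ|w_a|²`, so the stub's inequality holds outright for `#S ≤ p^{1/2−κ}` and the open
  content of the engine is exactly the window `p^{1/2−κ} < #S ≤ p^{1/2+δ₁}`.)
* `paleyForm_add_sub_paleyForm_sub` — polarisation `Q(u+v) − Q(u−v) = 4·B(u,v)` for the bilinear
  Paley–Hankel sum `B(u,v) = Σ_{a,b∈S} χ_p(a+b) u_a v_b`; `norm_paleyBilin_le_of_quad`: a quadratic bound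
  `|Q_p(S,·)| ≤ θ‖·‖²` on `S` gives `|B(u,v)| ≤ θ ‖u‖ ‖v‖` on `S`, and (`norm_charSum_le_of_quad`) the FLAT
  discrepancy bound `|Σ_{a∈A,b∈B} χ_p(a+b)| ≤ θ √(#A·#B)` for all `A, B ⊆ S`.

Honest framing: trivial cases of / identities around the OPEN engine, landed `--supports` the crux item;
the crux `FeketeSOSHard`, the engine and `stub_tameReduction` remain open; nothing here bears on
`VP ≠ VNP`.
-/

-- the line's namespace repeats a path segment by convention (same as the other paley-rip files)
set_option linter.dupNamespace false

namespace Summit.ValiantsHypothesis.ValiantsHypothesis.Theorems.FeketeSOSHardPaleyRIP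

open Finset
open scoped BigOperators

noncomputable section

section Polarisation

variable (p : ℕ) [Fact p.Prime]

/-- The Paley–Hankel matrix is symmetric: swapping the roles of `u` and `v` in the bilinear sum
`Σ_{a,b∈S} χ_p(a+b) u_a v_b` does not change it. [folklore] -/
theorem paleyBilin_comm (S : Finset ℕ) (u v : ℕ → ℂ) :
    ∑ a ∈ S, ∑ b ∈ S, ((legendreSym p ((a : ℤ) + b) : ℤ) : ℂ) * v a * u b =
      ∑ a ∈ S, ∑ b ∈ S, ((legendreSym p ((a : ℤ) + b) : ℤ) : ℂ) * u a * v b := by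
  rw [sum_comm]
  refine sum_congr rfl fun a _ => sum_congr rfl fun b _ => ?_
  rw [add_comm (b : ℤ) a]
  ring

/-- **Polarisation.** `Q_p(S, u+v) − Q_p(S, u−v) = 4 Σ_{a,b∈S} χ_p(a+b) u_a v_b`. [folklore] -/
theorem paleyForm_add_sub_paleyForm_sub (S : Finset ℕ) (u v : ℕ → ℂ) :
    paleyForm p S (fun a => u a + v a) - paleyForm p S (fun a => u a - v a) =
      4 * ∑ a ∈ S, ∑ b ∈ S, ((legendreSym p ((a : ℤ) + b) : ℤ) : ℂ) * u a * v b := by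
  have h1 : paleyForm p S (fun a => u a + v a) - paleyForm p S (fun a => u a - v a) =
      2 * (∑ a ∈ S, ∑ b ∈ S, ((legendreSym p ((a : ℤ) + b) : ℤ) : ℂ) * u a * v b) +
        2 * (∑ a ∈ S, ∑ b ∈ S, ((legendreSym p ((a : ℤ) + b) : ℤ) : ℂ) * v a * u b) := by
    unfold paleyForm
    rw [mul_sum, mul_sum, ← sum_add_distrib, ← sum_sub_distrib]
    refine sum_congr rfl fun a _ => ?_
    rw [mul_sum, mul_sum, ← sum_add_distrib, ← sum_sub_distrib]
    refine sum_congr rfl fun b _ => ?_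
    ring
  rw [h1, paleyBilin_comm]
  ring

/-- Parallelogram law for the weights on `S`: `Σ|u+v|² + Σ|u−v|² = 2Σ|u|² + 2Σ|v|²`. [folklore] -/
theorem sum_norm_sq_add_add_sum_norm_sq_sub (S : Finset ℕ) (u v : ℕ → ℂ) :
    (∑ a ∈ S, ‖u a + v a‖ ^ 2) + ∑ a ∈ S, ‖u a - v a‖ ^ 2 =
      2 * ∑ a ∈ S, ‖u a‖ ^ 2 + 2 * ∑ a ∈ S, ‖v a‖ ^ 2 := by
  rw [mul_sum, mul_sum, ← sum_add_distrib, ← sum_add_distrib]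
  refine sum_congr rfl fun a _ => ?_
  have h := parallelogram_law_with_norm ℝ (u a) (v a)
  nlinarith [h]

/-- From a quadratic to a half-bilinear bound: if `|Q_p(S,w)| ≤ θ Σ_{a∈S}|w_a|²` for all `w`, then
`|Σ_{a,b∈S} χ_p(a+b) u_a v_b| ≤ (θ/2)(Σ_{a∈S}|u_a|² + Σ_{a∈S}|v_a|²)`. [folklore] -/
theorem norm_paleyBilin_le_half_of_quad (θ : ℝ) (S : Finset ℕ)
    (hQ : ∀ w : ℕ → ℂ, ‖paleyForm p S w‖ ≤ θ * ∑ a ∈ S, ‖w a‖ ^ 2) (u v : ℕ → ℂ) :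
    ‖∑ a ∈ S, ∑ b ∈ S, ((legendreSym p ((a : ℤ) + b) : ℤ) : ℂ) * u a * v b‖ ≤
      θ / 2 * ((∑ a ∈ S, ‖u a‖ ^ 2) + ∑ a ∈ S, ‖v a‖ ^ 2) := by
  have hpol := paleyForm_add_sub_paleyForm_sub p S u v
  have h4 : ‖(4 : ℂ) * ∑ a ∈ S, ∑ b ∈ S, ((legendreSym p ((a : ℤ) + b) : ℤ) : ℂ) * u a * v b‖ ≤
      θ * ∑ a ∈ S, ‖u a + v a‖ ^ 2 + θ * ∑ a ∈ S, ‖u a - v a‖ ^ 2 := by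
    rw [← hpol]
    exact (norm_sub_le _ _).trans (add_le_add (hQ _) (hQ _))
  rw [norm_mul] at h4
  have h4' : ‖(4 : ℂ)‖ = 4 := by simp
  rw [h4', ← mul_add, sum_norm_sq_add_add_sum_norm_sq_sub] at h4
  linarith

/-- **Quadratic ⇒ bilinear.** If `|Q_p(S,w)| ≤ θ Σ_{a∈S}|w_a|²` for all `w`, then
`|Σ_{a,b∈S} χ_p(a+b) u_a v_b| ≤ θ · (Σ_{a∈S}|u_a|²)^{1/2} (Σ_{a∈S}|v_a|²)^{1/2}` for all `u, v`
(polarisation plus the scaling `u ↦ su`, `v ↦ s⁻¹v`). [folklore] -/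
theorem norm_paleyBilin_le_of_quad (θ : ℝ) (S : Finset ℕ)
    (hQ : ∀ w : ℕ → ℂ, ‖paleyForm p S w‖ ≤ θ * ∑ a ∈ S, ‖w a‖ ^ 2) (u v : ℕ → ℂ) :
    ‖∑ a ∈ S, ∑ b ∈ S, ((legendreSym p ((a : ℤ) + b) : ℤ) : ℂ) * u a * v b‖ ≤
      θ * Real.sqrt (∑ a ∈ S, ‖u a‖ ^ 2) * Real.sqrt (∑ a ∈ S, ‖v a‖ ^ 2) := by
  set X : ℝ := ∑ a ∈ S, ‖u a‖ ^ 2 with hX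
  set Y : ℝ := ∑ a ∈ S, ‖v a‖ ^ 2 with hY
  have hX0 : 0 ≤ X := sum_nonneg fun _ _ => sq_nonneg _
  have hY0 : 0 ≤ Y := sum_nonneg fun _ _ => sq_nonneg _
  -- degenerate cases: `u ≡ 0` on `S` or `v ≡ 0` on `S`
  by_cases hXz : X = 0
  · have hu : ∀ a ∈ S, u a = 0 := by
      intro a ha
      have hsum := hXz
      rw [hX] at hsum
      have h2 : ‖u a‖ ^ 2 = 0 := (sum_eq_zero_iff_of_nonneg (fun b _ => sq_nonneg ‖u b‖)).1 hsum a ha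
      exact norm_eq_zero.1 ((pow_eq_zero_iff two_ne_zero).1 h2)
    have hz : ∑ a ∈ S, ∑ b ∈ S, ((legendreSym p ((a : ℤ) + b) : ℤ) : ℂ) * u a * v b = 0 :=
      sum_eq_zero fun a ha => sum_eq_zero fun b _ => by rw [hu a ha]; ring
    rw [hz, norm_zero, hXz, Real.sqrt_zero, mul_zero, zero_mul]
  by_cases hYz : Y = 0
  · have hv : ∀ a ∈ S, v a = 0 := by
      intro a ha
      have hsum := hYz
      rw [hY] at hsum
      have h2 : ‖v a‖ ^ 2 = 0 := (sum_eq_zero_iff_of_nonneg (fun b _ => sq_nonneg ‖v b‖)).1 hsum a ha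
      exact norm_eq_zero.1 ((pow_eq_zero_iff two_ne_zero).1 h2)
    have hz : ∑ a ∈ S, ∑ b ∈ S, ((legendreSym p ((a : ℤ) + b) : ℤ) : ℂ) * u a * v b = 0 :=
      sum_eq_zero fun a _ => sum_eq_zero fun b hb => by rw [hv b hb]; ring
    rw [hz, norm_zero, hYz, Real.sqrt_zero, mul_zero]
  have hXp : 0 < X := lt_of_le_of_ne hX0 (Ne.symm hXz)
  have hYp : 0 < Y := lt_of_le_of_ne hY0 (Ne.symm hYz)
  -- the scaling parameter `s` with `s² = √Y/√X`
  set s : ℝ := Real.sqrt (Real.sqrt Y / Real.sqrt X) with hs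
  have hsX : 0 < Real.sqrt X := Real.sqrt_pos.2 hXp
  have hsY : 0 < Real.sqrt Y := Real.sqrt_pos.2 hYp
  have hs2 : s ^ 2 = Real.sqrt Y / Real.sqrt X := by
    rw [hs, Real.sq_sqrt (div_pos hsY hsX).le]
  have hspos : 0 < s := by rw [hs]; exact Real.sqrt_pos.2 (div_pos hsY hsX)
  have hsne : (s : ℂ) ≠ 0 := by exact_mod_cast hspos.ne'
  -- apply the half-bound to `(s u, s⁻¹ v)`
  have hhalf := norm_paleyBilin_le_half_of_quad p θ S hQ (fun a => (s : ℂ) * u a)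
    (fun a => (s : ℂ)⁻¹ * v a)
  have hsame : ∑ a ∈ S, ∑ b ∈ S, ((legendreSym p ((a : ℤ) + b) : ℤ) : ℂ) * ((s : ℂ) * u a) *
      ((s : ℂ)⁻¹ * v b) = ∑ a ∈ S, ∑ b ∈ S, ((legendreSym p ((a : ℤ) + b) : ℤ) : ℂ) * u a * v b := by
    refine sum_congr rfl fun a _ => sum_congr rfl fun b _ => ?_
    field_simp
  have hnu : ∑ a ∈ S, ‖(s : ℂ) * u a‖ ^ 2 = s ^ 2 * X := by
    rw [hX, mul_sum]
    refine sum_congr rfl fun a _ => ?_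
    rw [norm_mul, mul_pow, Complex.norm_real, Real.norm_eq_abs, sq_abs]
  have hnv : ∑ a ∈ S, ‖(s : ℂ)⁻¹ * v a‖ ^ 2 = (s ^ 2)⁻¹ * Y := by
    rw [hY, mul_sum]
    refine sum_congr rfl fun a _ => ?_
    rw [norm_mul, mul_pow, norm_inv, Complex.norm_real, Real.norm_eq_abs, inv_pow, sq_abs]
  rw [hsame, hnu, hnv, hs2] at hhalf
  -- `s² X + s⁻² Y = 2 √X √Y`
  have hXe : Real.sqrt X * Real.sqrt X = X := Real.mul_self_sqrt hX0
  have hYe : Real.sqrt Y * Real.sqrt Y = Y := Real.mul_self_sqrt hY0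
  have hkey : Real.sqrt Y / Real.sqrt X * X + (Real.sqrt Y / Real.sqrt X)⁻¹ * Y =
      2 * (Real.sqrt X * Real.sqrt Y) := by
    field_simp
    nlinarith [hXe, hYe]
  rw [hkey] at hhalf
  calc ‖∑ a ∈ S, ∑ b ∈ S, ((legendreSym p ((a : ℤ) + b) : ℤ) : ℂ) * u a * v b‖
      ≤ θ / 2 * (2 * (Real.sqrt X * Real.sqrt Y)) := hhalf
    _ = θ * Real.sqrt X * Real.sqrt Y := by ring

/-- Bilinear sums against indicator weights are the plain character sums over `A × B` (`A, B ⊆ S`).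
[folklore] -/
theorem paleyBilin_indicator (S A B : Finset ℕ) (hA : A ⊆ S) (hB : B ⊆ S) :
    ∑ a ∈ S, ∑ b ∈ S, ((legendreSym p ((a : ℤ) + b) : ℤ) : ℂ) * (if a ∈ A then (1 : ℂ) else 0) *
        (if b ∈ B then (1 : ℂ) else 0) =
      ∑ a ∈ A, ∑ b ∈ B, ((legendreSym p ((a : ℤ) + b) : ℤ) : ℂ) := by
  classical
  have hterm : ∀ a b : ℕ, ((legendreSym p ((a : ℤ) + b) : ℤ) : ℂ) * (if a ∈ A then (1 : ℂ) else 0) *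
      (if b ∈ B then (1 : ℂ) else 0) =
      if a ∈ A then (if b ∈ B then ((legendreSym p ((a : ℤ) + b) : ℤ) : ℂ) else 0) else 0 := by
    intro a b
    split_ifs <;> simp
  simp_rw [hterm]
  have hout : ∀ a ∈ S, (∑ b ∈ S, if a ∈ A then
      (if b ∈ B then ((legendreSym p ((a : ℤ) + b) : ℤ) : ℂ) else 0) else 0) =
      if a ∈ A then ∑ b ∈ B, ((legendreSym p ((a : ℤ) + b) : ℤ) : ℂ) else 0 := by
    intro a _
    split_ifs with ha
    · rw [← sum_filter, Finset.filter_mem_eq_inter, inter_eq_right.2 hB]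
    · simp
  rw [sum_congr rfl hout, ← sum_filter, Finset.filter_mem_eq_inter, inter_eq_right.2 hA]

/-- Indicator weights have `Σ_{a∈S} |1_A(a)|² = #A` for `A ⊆ S`. [folklore] -/
theorem sum_norm_sq_indicator (S A : Finset ℕ) (hA : A ⊆ S) :
    ∑ a ∈ S, ‖(if a ∈ A then (1 : ℂ) else 0)‖ ^ 2 = (A.card : ℝ) := by
  classical
  have hA' : S.filter (fun a => a ∈ A) = A := by
    ext a; simp only [mem_filter]; exact ⟨fun h => h.2, fun h => ⟨hA h, h⟩⟩
  have h : ∀ a ∈ S, ‖(if a ∈ A then (1 : ℂ) else 0)‖ ^ 2 = if a ∈ A then (1 : ℝ) else 0 := by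
    intro a _; split_ifs <;> simp
  rw [sum_congr rfl h, ← sum_filter, hA']
  simp

/-- **Quadratic bound on `S` ⇒ flat discrepancy on subsets of `S`.** If `|Q_p(S,w)| ≤ θ Σ|w_a|²` for all
`w`, then `|Σ_{a∈A, b∈B} χ_p(a+b)| ≤ θ √(#A · #B)` for all `A, B ⊆ S`. [folklore] -/
theorem norm_charSum_le_of_quad (θ : ℝ) (S : Finset ℕ)
    (hQ : ∀ w : ℕ → ℂ, ‖paleyForm p S w‖ ≤ θ * ∑ a ∈ S, ‖w a‖ ^ 2)
    (A B : Finset ℕ) (hA : A ⊆ S) (hB : B ⊆ S) :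
    ‖∑ a ∈ A, ∑ b ∈ B, ((legendreSym p ((a : ℤ) + b) : ℤ) : ℂ)‖ ≤
      θ * Real.sqrt ((A.card : ℝ) * B.card) := by
  classical
  have h := norm_paleyBilin_le_of_quad p θ S hQ (fun a => if a ∈ A then (1 : ℂ) else 0)
    (fun b => if b ∈ B then (1 : ℂ) else 0)
  rw [paleyBilin_indicator p S A B hA hB, sum_norm_sq_indicator S A hA,
    sum_norm_sq_indicator S B hB] at h
  rw [Real.sqrt_mul (Nat.cast_nonneg _), ← mul_assoc]
  exact h

end Polarisation

end

end Summit.ValiantsHypothesis.ValiantsHypothesis.Theorems.FeketeSOSHardPaleyRIP
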